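import Mathlib
import Literature.MathematicalPhysics.StatisticalMechanics.StickyChain

/-!
# Crux `ExactCertificate` (stmt-AtomisticToContinuum-11959), line `closure-makes-nogap-exact`,
# Transfer skeleton V (`OneCrossingChainCertificate`): stub `stub_classPosType`

Support file for the crux `ThreeConeCertificate.ExactCertificate`, d = 1 transfer skeleton V
(`Cruxes.ExactCertificate.Transfer1D.OneCrossingChainCertificate`).  This file proves the
registered stub `stub_classPosType`, the class form of `stub_posTypeOfPsi`
(file `…Transfer1DPosType.lean`): the doubling trick `F_a = -¼ Δ_a Ψ_a` for an ABSTRACT pair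
potential `V : ℝ → ℝ`.

With `b_k = (k+1) a` and `S(c) = Σ_k (k+1) V(c + b_k)` (convergent for `c ≥ 0` by hypothesis), the
tail interpolant is `F_a(x) = S(|x+a|) - 2 S(|x|) + S(|x-a|)` and `Ψ_a(y) = -4 S(|y|)`.  We prove:
if `Ψ_a` is of positive type on `ℝ` (all finite Gram forms `Σ_{ij} w_i w_j Ψ_a(x_i - x_j)` are
`≥ 0`), then `F_a ∘ dist` is of positive type on `ℝ¹ = EuclideanSpace ℝ (Fin 1)`.

Proof: (0) the summability hypothesis at `c = |δ+a|, |δ|, |δ-a| ≥ 0` splits the single `tsum`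
defining `F_a` into three (`classPosType_tsum_three`); (1) on the line
`dist (y i) (y j) = |x_i - x_j|` and `{||δ|+a|, ||δ|-a|} = {|δ+a|, |δ-a|}`, so the `(i,j)` summand
is `-¼ w_i w_j [Ψ(δ+a) - 2Ψ(δ) + Ψ(δ-a)]`, `δ = x_i - x_j` (`classPosType_summand_eq`); (2) applying
the hypothesis to the `2n` points `(x, x + a)` with weights `(w, -w)` gives exactly
`0 ≤ Σ w_i w_j [2Ψ(δ) - Ψ(δ+a) - Ψ(δ-a)]` (`classPosType_doubling`).

All `[folklore]` (finite Gram-form bookkeeping); no named facts are used.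
-/

noncomputable section

namespace Summit.AtomisticToContinuum.Crystallization.Theorems.ThreeConeCertificateExactCertificate.Transfer1D

open Literature.MathematicalPhysics.StatisticalMechanics MeasureTheory Set Filter Topology
open scoped BigOperators

/-- Splitting the single `tsum` of the second difference into three, given that all three series
`Σ_k (k+1) V(c + (k+1)a)`, `c ∈ {p, q, r}`, converge. [folklore] -/
theorem classPosType_tsum_three (V : ℝ → ℝ) {a p q r : ℝ}
    (hp : Summable (fun k : ℕ => ((k : ℝ) + 1) * V (p + ((k : ℝ) + 1) * a)))
    (hq : Summable (fun k : ℕ => ((k : ℝ) + 1) * V (q + ((k : ℝ) + 1) * a)))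
    (hr : Summable (fun k : ℕ => ((k : ℝ) + 1) * V (r + ((k : ℝ) + 1) * a))) :
    ∑' k : ℕ, ((k : ℝ) + 1) * (V (p + ((k : ℝ) + 1) * a)
      - 2 * V (q + ((k : ℝ) + 1) * a) + V (r + ((k : ℝ) + 1) * a))
    = (∑' k : ℕ, ((k : ℝ) + 1) * V (p + ((k : ℝ) + 1) * a))
      - 2 * (∑' k : ℕ, ((k : ℝ) + 1) * V (q + ((k : ℝ) + 1) * a))
      + ∑' k : ℕ, ((k : ℝ) + 1) * V (r + ((k : ℝ) + 1) * a) := by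
  have H := ((hp.hasSum.sub (hq.hasSum.mul_left 2)).add hr.hasSum)
  exact (H.congr_fun fun k => by ring).tsum_eq

/-- Split plus parity: with `S(c) = Σ_k (k+1)V(c + (k+1)a)` (convergent for `c ≥ 0`) and
`Ψ(y) = -4 S(|y|)`,
`Σ_k (k+1)[V(||δ|+a| + b_k) - 2V(||δ|| + b_k) + V(||δ|-a| + b_k)] = -¼[Ψ(δ+a) - 2Ψ(δ) + Ψ(δ-a)]`
(for `δ < 0` the two outer terms swap). [folklore] -/
theorem classPosType_summand_eq (V : ℝ → ℝ) {a : ℝ}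
    (hS : ∀ y : ℝ, 0 ≤ y → Summable (fun k : ℕ => ((k : ℝ) + 1) * V (y + ((k : ℝ) + 1) * a)))
    (δ : ℝ) :
    ∑' k : ℕ, ((k : ℝ) + 1) * (V (|(|δ| + a)| + ((k : ℝ) + 1) * a)
      - 2 * V (|(|δ|)| + ((k : ℝ) + 1) * a) + V (|(|δ| - a)| + ((k : ℝ) + 1) * a))
    = -(1 / 4) * ((-4 * ∑' k : ℕ, ((k : ℝ) + 1) * V (|δ + a| + ((k : ℝ) + 1) * a))
      - 2 * (-4 * ∑' k : ℕ, ((k : ℝ) + 1) * V (|δ| + ((k : ℝ) + 1) * a))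
      + (-4 * ∑' k : ℕ, ((k : ℝ) + 1) * V (|δ - a| + ((k : ℝ) + 1) * a))) := by
  rw [classPosType_tsum_three V (hS _ (abs_nonneg _)) (hS _ (abs_nonneg _)) (hS _ (abs_nonneg _)),
    abs_abs]
  rcases le_or_gt 0 δ with h | h
  · rw [abs_of_nonneg h]
    ring
  · rw [abs_of_neg h, show |-δ + a| = |δ - a| by rw [neg_add_eq_sub, abs_sub_comm],
      show |-δ - a| = |δ + a| by rw [← neg_add', abs_neg]]
    ring

/-- The doubling trick for an arbitrary kernel `Φ` of positive type on `ℝ`: evaluating the Gram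
form at the `2n` points `(x, x + a)` with weights `(w, -w)` gives
`0 ≤ Σ_{ij} w_i w_j · (-¼)[Φ(δ+a) - 2Φ(δ) + Φ(δ-a)]`, `δ = x_i - x_j`. [folklore] -/
theorem classPosType_doubling (Φ : ℝ → ℝ) (a : ℝ)
    (hΦ : ∀ (n : ℕ) (x : Fin n → ℝ) (w : Fin n → ℝ), 0 ≤ ∑ i, ∑ j, w i * w j * Φ (x i - x j))
    (n : ℕ) (x : Fin n → ℝ) (w : Fin n → ℝ) :
    0 ≤ ∑ i, ∑ j, w i * w j *
      (-(1 / 4) * (Φ (x i - x j + a) - 2 * Φ (x i - x j) + Φ (x i - x j - a))) := by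
  have h := hΦ (n + n) (Fin.append x fun i => x i + a) (Fin.append w fun i => -w i)
  simp only [Fin.sum_univ_add, Fin.append_left, Fin.append_right, add_sub_add_right_eq_sub] at h
  simp only [← sub_sub, add_sub_right_comm] at h
  refine le_of_le_of_eq (mul_nonneg (by norm_num : (0 : ℝ) ≤ 1 / 4) h) ?_
  simp only [← Finset.sum_add_distrib, Finset.mul_sum]
  refine Finset.sum_congr rfl fun i _ => Finset.sum_congr rfl fun j _ => ?_
  ring

/-- **Stub `stub_classPosType`** — THE DOUBLING TRICK `F_a = -¼ Δ_a Ψ_a` (class form of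
`stub_posTypeOfPsi`): for an abstract pair potential `V` with `Σ_k (k+1) V(y + (k+1)a)` convergent
for every `y ≥ 0`, positive type of `Ψ_a(y) = -4 Σ_k (k+1) V(|y| + (k+1)a)` on `ℝ` gives positive
type of the tail interpolant
`F_a(x) = Σ_k (k+1)[V(|x+a| + (k+1)a) - 2V(|x| + (k+1)a) + V(|x-a| + (k+1)a)]`, as a function of
the distance, on `ℝ¹ = EuclideanSpace ℝ (Fin 1)` (Gram form of `F_a` on `{x_i}` = ¼ · Gram form of
`Ψ_a` on `{x_i} ∪ {x_i + a}` with weights `(w, -w)`). [folklore] -/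
theorem stub_classPosType : ∀ (V : ℝ → ℝ) (a : ℝ), 0 < a →
    (∀ y : ℝ, 0 ≤ y → Summable (fun k : ℕ => ((k : ℝ) + 1) * V (y + ((k : ℝ) + 1) * a))) →
    (∀ (n : ℕ) (x : Fin n → ℝ) (w : Fin n → ℝ),
      0 ≤ ∑ i, ∑ j, w i * w j * (-4 * ∑' k : ℕ, ((k : ℝ) + 1) * V (|x i - x j| + ((k : ℝ) + 1) * a))) →
    ∀ (n : ℕ) (y : Fin n → EuclideanSpace ℝ (Fin 1)) (w : Fin n → ℝ),
      0 ≤ ∑ i, ∑ j, w i * w j * ∑' k : ℕ, ((k : ℝ) + 1) *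
        (V (|dist (y i) (y j) + a| + ((k : ℝ) + 1) * a) - 2 * V (|dist (y i) (y j)| + ((k : ℝ) + 1) * a)
          + V (|dist (y i) (y j) - a| + ((k : ℝ) + 1) * a)) := by
  intro V a _ha hS hΨ n y w
  simp only [StickyChain.dist_eq_abs_sub, classPosType_summand_eq V hS]
  exact classPosType_doubling (fun t => -4 * ∑' k : ℕ, ((k : ℝ) + 1) * V (|t| + ((k : ℝ) + 1) * a))
    a hΨ n (fun i => y i 0) w

end Summit.AtomisticToContinuum.Crystallization.Theorems.ThreeConeCertificateExactCertificate.Transfer1D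

end
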